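import Literature.AlgebraicGeometry.Frobenioids.UnitTrivializationSquareSlim
import Literature.AlgebraicGeometry.Frobenioids.EquivalenceFrobeniusQuasiIsotropic
import Literature.AlgebraicGeometry.Frobenioids.PerfectionFunctorialityUnique
import Literature.AlgebraicGeometry.Frobenioids.PerfectionRigidity
import HarnessLib

/-!
# Frobenioids I, Theorem 3.4 (iii), (iv): the typed schemata `Thm34iii_pf`, `Thm34iv_untr` of
# `BaseCategoryTheoreticity.lean` AT THE FROBENIOIDS — the perfection square for perfect type, and the
# unit-trivialisation square at THE `Ψ^istr` from the preservation part of (iv)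

Mochizuki, *The geometry of Frobenioids I: the general theory*, Kyushu J. Math. **62** (2008)
293–400, Thm. 3.4 (iii) p. 62 l. 42 – p. 63 l. 2 and (iv) p. 62 l. 36 – p. 63 l. 21
[cite: MochizukiFrdI2008, Thm. 3.4 (iv) p.63]; proofs p. 64 ll. 26–32 ((iii), square and rigidity) and
p. 66 ll. 36–41 ((iv): "since `Ψ` preserves `O^×(−)`, the existence and `1`-uniqueness of a `1`-commutative
diagram as in the statement of Theorem 3.4, (iv), follow immediately from the definition of `C_i^un-tr`; since
`C₁^un-tr`, `C₂^un-tr` are of unit-trivial type, the asserted rigidity follows formally from Proposition 1.13, (ii)").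

PROOF-ONLY companion of `BaseCategoryTheoreticity.lean` (seat abc-iut-L1-t3), written for the abc-iut cell's
FROZEN FACT-LIST rows F-0904 `PreFrobenioidData.Thm34iii_pf` and F-0906 `PreFrobenioidData.Thm34iv_untr`
(seat abc-iut-f-019). Both declarations are SCHEMATA over the data-only interface `PreFrobenioidData` with a
free datum (perfection data `P_i`, resp. a functor `Ψ^istr`), whose universal closures are false
(`BaseCategoryTheoreticitySchemaRefutations.lean`); the paper's statements are their INSTANCES at the operations
`PreFrobenioidData.ofFunctor Φ_i F_i` of Frobenioids, at THE perfections `PreFrobenioidData.perfection hF_i`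
(Def. 3.1 (iii)) and at THE `Ψ^istr` of Thm. 3.4 (i) — the restriction `Ψ.congrFullSubcategory _` of `Ψ` to the
isotropic objects, named under quasi-isotropic type (Thm. 3.4 (i): `Ψ` preserves isotropic objects, seat
abc-iut-L1-t13's `FrdI.isotropicObjects_inverseImage`). Proved here, base-agnostic (no hypothesis on `D₁, D₂`
beyond those inside the typed statements):

* `FrdI.thm34iv_untr_ofFunctor_of_thm34iv` — the typed (iv) unit-trivialisation square at THE `Ψ^istr`, for
  every pair of Frobenioids of quasi-isotropic type, FROM the typed preservation part `PreFrobenioidData.Thm34iv`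
  for `Ψ` and `Ψ⁻¹` (its clause "`Ψ` preserves `O^×(−)`" makes `Ψ^istr` and its quasi-inverse preserve `≈^{O^×}`,
  seat abc-iut-L1-d6's `unitEquiv_map_of_units`; then seat abc-iut-L1-d6/w4's `PreFrobenioid.thm34iv_untr_of_unitEquiv`
  gives the `1`-unique square, the equivalence and the rigidity of the composites). The unconditional instance
  (feeding the cell's theorem `FrdI.Thm34iv_holds`) is the companion `BaseCategoryTheoreticityInstancesClosed.lean`.
* `FrdI.thm34iii_pf_ofFunctor_of_isOfPerfectType` — the typed (iii) perfection square AS TYPED (bare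
  `1`-uniqueness) at THE perfections, for Frobenioids of PERFECT type: `C_i → C_i^pf` are equivalences (Prop. 3.2
  (iii), seat abc-iut-L1-d1's `Perfection.toPf_isEquivalence`), `Ψ^pf := (C₁^pf → C₁) ⋙ Ψ ⋙ (C₂ → C₂^pf)`;
  rigidity of the composites by Prop. 1.13 (ii) (seat abc-iut-L1-d1/w4's `PreFrobenioid.isRigidFunctor_toPf_comp_of_iso`,
  under (a)'s clause (c) Frobenius-normalized type). The bare reading is FALSE outside perfect type (seat
  abc-iut-L1-d4, `DegreeModel.not_thm34iii_pf`); the structure-compatible square `pfSquareR_map` is the faithful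
  general reading. Variant `…_of_isFrobeniusCompatible`: `C₁` of perfect type and `Ψ` Frobenius-compatible ⇒ the
  typed statement with `Ψ^pf = Perfection.map` (`Perfection.oneUniqueSquare_map_of_isOfPerfectType`).

No definition; no statement of the paper is restated or strengthened; nothing here bears on [IUTchIII].
-/

namespace Literature.AlgebraicGeometry.Frobenioids

namespace FrdI

open CategoryTheory PreFrobenioidData

universe w v v' u u'

section Two

variable {D₁ : Type u} [Category.{v} D₁] {Φ₁ : D₁ᵒᵖ ⥤ CommMonCat.{w}} {C₁ : Type u'} [Category.{v'} C₁]
  {D₂ : Type u} [Category.{v} D₂] {Φ₂ : D₂ᵒᵖ ⥤ CommMonCat.{w}} {C₂ : Type u'} [Category.{v'} C₂]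
  {F₁ : C₁ ⥤ ElemFrobenioid Φ₁} {F₂ : C₂ ⥤ ElemFrobenioid Φ₂}

/-! ### (iv), the unit-trivialisation square at THE `Ψ^istr`, from the preservation part of (iv) -/

/-- The class of isotropic objects of a Frobenioid (data-level rendering `(ofFunctor Φ F).isotropicObjects`) is
closed under isomorphisms. [cite: MochizukiFrdI2008, Def. 1.2 (iv) p.23] -/
theorem isClosedUnderIsomorphisms_isotropicObjects_ofFunctor (hF₂ : PreFrobenioid.IsFrobenioid F₂) :
    (ofFunctor Φ₂ F₂).isotropicObjects.IsClosedUnderIsomorphisms :=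
  ⟨fun e hX => (ofFunctor_isIsotropic F₂ _).2
    (PreFrobenioid.IsIsotropic.of_iso hF₂.isPreFrobenioid e.symm ((ofFunctor_isIsotropic F₂ _).1 hX))⟩

/-- Thm. 3.4 (i) at the data level: for Frobenioids of quasi-isotropic type, the isotropic objects of `C₂`
pulled back along `Ψ` are the isotropic objects of `C₁` (seat abc-iut-L1-t13's
`FrdI.isotropicObjects_inverseImage`, transported through `PreFrobenioid.isotropicObjects_ofFunctor`).
[cite: MochizukiFrdI2008, Thm. 3.4 (i) p.62] -/
theorem isotropicObjects_ofFunctor_inverseImage (hF₁ : PreFrobenioid.IsFrobenioid F₁)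
    (hq₁ : (ofFunctor Φ₁ F₁).IsOfQuasiIsotropicType) (hq₂ : (ofFunctor Φ₂ F₂).IsOfQuasiIsotropicType)
    (Ψ : C₁ ≌ C₂) :
    (ofFunctor Φ₂ F₂).isotropicObjects.inverseImage Ψ.functor = (ofFunctor Φ₁ F₁).isotropicObjects := by
  rw [PreFrobenioid.isotropicObjects_ofFunctor (F := F₁), PreFrobenioid.isotropicObjects_ofFunctor (F := F₂)]
  exact isotropicObjects_inverseImage hF₁ hq₁ hq₂ Ψ

/-- **[FrdI] Thm. 3.4 (iv), the unit-trivialisation square, AS TYPED at the Frobenioids and at THE `Ψ^istr`,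
FROM the typed preservation part of (iv) for `Ψ` and `Ψ⁻¹`**: for Frobenioids of quasi-isotropic type (clause of
(a); it names `Ψ^istr :=` the restriction of `Ψ` to the isotropic objects) and an equivalence `Ψ` such that the
typed `PreFrobenioidData.Thm34iv` holds for `Ψ` and for `Ψ⁻¹`, the typed `PreFrobenioidData.Thm34iv_untr` holds:
under (a) standard type, (b) `HypB`, (c) Frobenius-slim bases there is a `1`-unique equivalence
`Ψ^un-tr : C₁^un-tr ⥲ C₂^un-tr` with `Ψ^un-tr ∘ (C₁^istr → C₁^un-tr) ≅ (C₂^istr → C₂^un-tr) ∘ Ψ^istr`, and for slim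
bases both composites are rigid. Printed proof p. 66: "since `Ψ` preserves `O^×(−)`" (the units clause of (iv),
for `Ψ` and `Ψ⁻¹`, whence `Ψ^istr`, `(Ψ^istr)⁻¹` preserve `≈^{O^×}`) "… follow immediately from the definition of
`C_i^un-tr`" (`PreFrobenioid.thm34iv_untr_of_unitEquiv`). [cite: MochizukiFrdI2008, Thm. 3.4 (iv) p.63] -/
theorem thm34iv_untr_ofFunctor_of_thm34iv (hF₁ : PreFrobenioid.IsFrobenioid F₁)
    (hF₂ : PreFrobenioid.IsFrobenioid F₂) (hq₁ : (ofFunctor Φ₁ F₁).IsOfQuasiIsotropicType)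
    (hq₂ : (ofFunctor Φ₂ F₂).IsOfQuasiIsotropicType) (Ψ : C₁ ≌ C₂)
    [(ofFunctor Φ₂ F₂).isotropicObjects.IsClosedUnderIsomorphisms]
    (h4 : (ofFunctor Φ₁ F₁).Thm34iv (ofFunctor Φ₂ F₂) Ψ) (h4' : (ofFunctor Φ₂ F₂).Thm34iv (ofFunctor Φ₁ F₁) Ψ.symm) :
    (ofFunctor Φ₁ F₁).Thm34iv_untr (ofFunctor Φ₂ F₂) Ψ
      (Ψ.congrFullSubcategory (isotropicObjects_ofFunctor_inverseImage hF₁ hq₁ hq₂ Ψ)).functor := by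
  intro hs₁ hs₂ hB hfs₁ hfs₂
  have hB' : (ofFunctor Φ₂ F₂).HypB (ofFunctor Φ₁ F₁) Ψ.symm := fun h₂ h₁ => ⟨(hB h₁ h₂).2, (hB h₁ h₂).1⟩
  -- (iv), preservation of units, for `Ψ` and for `Ψ⁻¹`
  have hU := (h4 hs₁ hs₂ hB hfs₁ hfs₂).2.1
  have hU' := (h4' hs₂ hs₁ hB' hfs₂ hfs₁).2.1
  let G := Ψ.congrFullSubcategory (isotropicObjects_ofFunctor_inverseImage hF₁ hq₁ hq₂ Ψ)
  -- hence `Ψ^istr` and its quasi-inverse preserve unit-equivalence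
  have hG : ∀ ⦃A B : (ofFunctor Φ₁ F₁).Istr⦄ (α₁ α₂ : A ⟶ B), (ofFunctor Φ₁ F₁).UnitEquiv α₁ α₂ →
      (ofFunctor Φ₂ F₂).UnitEquiv (G.functor.map α₁) (G.functor.map α₂) :=
    unitEquiv_map_of_units _ _ G.functor fun X δ hδ => ⟨Ψ.functor.mapIso δ, hU X.obj δ hδ, rfl⟩
  have hG' : ∀ ⦃A B : (ofFunctor Φ₂ F₂).Istr⦄ (β₁ β₂ : A ⟶ B), (ofFunctor Φ₂ F₂).UnitEquiv β₁ β₂ →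
      (ofFunctor Φ₁ F₁).UnitEquiv (G.inverse.map β₁) (G.inverse.map β₂) :=
    unitEquiv_map_of_units _ _ G.inverse fun X δ hδ => ⟨Ψ.inverse.mapIso δ, hU' X.obj δ hδ, rfl⟩
  exact PreFrobenioid.thm34iv_untr_of_unitEquiv hF₂ Ψ G hG hG' hs₁ hs₂ hB hfs₁ hfs₂

/-! ### (iii), the perfection square at THE perfections, perfect type -/

/-- **[FrdI] Thm. 3.4 (iii), the perfection square AS TYPED (bare `1`-uniqueness) at THE perfections, for
Frobenioids of PERFECT type**: `C_i → C_i^pf` are equivalences (Prop. 3.2 (iii)), `Ψ^pf := (C₁^pf → C₁) ⋙ Ψ ⋙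
(C₂ → C₂^pf)` is an equivalence making the square `1`-commute, any functor making it `1`-commute is isomorphic
to `Ψ^pf`, and for slim bases both composites are rigid (Prop. 1.13 (ii), under (a)'s clause (c)
Frobenius-normalized type). [cite: MochizukiFrdI2008, Thm. 3.4 (iii) p.62] -/
theorem thm34iii_pf_ofFunctor_of_isOfPerfectType (hF₁ : PreFrobenioid.IsFrobenioid F₁)
    (hF₂ : PreFrobenioid.IsFrobenioid F₂) (hP₁ : PreFrobenioid.IsOfPerfectType F₁)
    (hP₂ : PreFrobenioid.IsOfPerfectType F₂) (Ψ : C₁ ≌ C₂) :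
    (ofFunctor Φ₁ F₁).Thm34iii_pf (ofFunctor Φ₂ F₂) Ψ (perfection hF₁) (perfection hF₂) := by
  intro _ hs₂ _
  haveI := PreFrobenioid.Perfection.perfection_toPf_isEquivalence hF₁ hP₁
  haveI := PreFrobenioid.Perfection.perfection_toPf_isEquivalence hF₂ hP₂
  let Ψpf : (perfection hF₁).Pf ⥤ (perfection hF₂).Pf :=
    (perfection hF₁).toPf.inv ⋙ Ψ.functor ⋙ (perfection hF₂).toPf
  -- `1`-commutativity: `Ψ ⋙ toPf₂ ≅ toPf₁ ⋙ toPf₁⁻¹ ⋙ Ψ ⋙ toPf₂`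
  let comm : Ψ.functor ⋙ (perfection hF₂).toPf ≅ (perfection hF₁).toPf ⋙ Ψpf :=
    (Functor.leftUnitor _).symm ≪≫
      Functor.isoWhiskerRight (perfection hF₁).toPf.asEquivalence.unitIso (Ψ.functor ⋙ (perfection hF₂).toPf) ≪≫
      Functor.associator _ _ _
  refine ⟨Ψpf, ⟨inferInstance, ⟨comm⟩, fun B' hB' => ?_⟩, fun _ hD₂ => ?_⟩
  · obtain ⟨i⟩ := hB'
    exact PreFrobenioid.Perfection.iso_of_toPf_comp_iso (hF₁ := hF₁) hP₁ (i.symm ≪≫ comm)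
  · exact PreFrobenioid.isRigidFunctor_toPf_comp_of_iso hF₂ hD₂ hs₂.frobeniusNormalized Ψ _ Ψpf comm

/-- **[FrdI] Thm. 3.4 (iii), the perfection square AS TYPED at THE perfections, `C₁` of perfect type and `Ψ`
compatible with arrows of Frobenius type and their degrees** (`C₂` arbitrary): `Ψ^pf := Perfection.map` (seat
abc-iut-L1-d1), `1`-unique by `Perfection.oneUniqueSquare_map_of_isOfPerfectType`, composites rigid by Prop. 1.13
(ii). Frobenius-compatibility is the conclusion of Thm. 3.4 (iii) when `Ψ^{ℕ≥1} = id` (companion file).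
[cite: MochizukiFrdI2008, Thm. 3.4 (iii) p.62] -/
theorem thm34iii_pf_ofFunctor_of_isOfPerfectType_of_isFrobeniusCompatible
    (hF₁ : PreFrobenioid.IsFrobenioid F₁) (hF₂ : PreFrobenioid.IsFrobenioid F₂)
    (hP₁ : PreFrobenioid.IsOfPerfectType F₁) (Ψ : C₁ ≌ C₂)
    (hΨ : PreFrobenioid.IsFrobeniusCompatible F₁ F₂ Ψ.functor) :
    (ofFunctor Φ₁ F₁).Thm34iii_pf (ofFunctor Φ₂ F₂) Ψ (perfection hF₁) (perfection hF₂) := by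
  intro _ hs₂ _
  refine ⟨PreFrobenioid.Perfection.map (hF₁ := hF₁) (hF₂ := hF₂) hΨ,
    PreFrobenioid.Perfection.oneUniqueSquare_map_of_isOfPerfectType (hF₁ := hF₁) (hF₂ := hF₂) hP₁ Ψ hΨ,
    fun _ hD₂ => ?_⟩
  exact PreFrobenioid.isRigidFunctor_toPf_comp_of_iso hF₂ hD₂ hs₂.frobeniusNormalized Ψ _ _
    (PreFrobenioid.Perfection.toPfCompMapIso (hF₁ := hF₁) (hF₂ := hF₂) hΨ).symm

end Two

end FrdI

end Literature.AlgebraicGeometry.Frobenioids
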